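import Summits.RiemannHypothesis.RiemannHypothesis.Theorems.PfPersistenceTowerLaw
import Summits.RiemannHypothesis.RiemannHypothesis.Theorems.GroundBartaPolarPerronFrobeniusEvenSectorNegativity
import Summits.RiemannHypothesis.RiemannHypothesis.Theorems.SoloInformedQuasiWeilCriterion
import HarnessLib

/-!
# PfPersistence (barrier-typer, gen 14) — the parity-tower LOG LAW (pf PF-C9) is RH-strength:
# a correction of record

Cell `pub-rhpf` (RH Perron–Frobenius persistence).  HONEST FRAMING: long-odds MECHANISM SEARCH; no RH
claims.  Everything below is RH-free and kernel-checked; the tower laws are HYPOTHESES typed in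
`PfPersistenceTowerLaw.lean` (`towerRatio εev εod a = εod a / εev a`, `TowerDominance`, `TowerLogLaw` =
`log r(a) ~ 4a`), asserted there and here for NO pair of level functions.

Correction of WHAT.  The typer's verdicts V10 (gen 11) and V18 wording (PF.md §18.4 addendum: "the binder
`∀ᶠ a, 0 < weilEvenGroundEnergy a`, not any theorem of the file, is the typed place where the law is RH-shaped;
no decl relates it to RH") understated the strength of the QUANTITATIVE law.  The tree already contains, RH-free:
(i) Bombieri's a-priori floor `ε(a) ≥ −C(1+a)eᵃ` (`weilGroundEnergy_ge_neg_exp`, `SoloInformedQuasiWeilCriterion`),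
(ii) `ε ≤ ε_od`, `ε ≤ ε_ev` and the monotonicity `ε_od(a) ≤ ε_od(1)` (`a ≥ 1`) (`WeilOddGroundState`,
`WeilGroundEnergyParitySplit`), (iii) off RH, `ε_ev(a) ≤ −η < 0` on all large windows
(`PolarPerronFrobenius.weilEvenGroundEnergy_le_neg_of_not_riemannHypothesis`).  Hence off RH
`|ε_od(a)/ε_ev(a)| ≤ (K/η)(1+a)eᵃ`: the modulus of the parity-tower ratio grows AT MOST exponentially with
rate `1`.  So:

* `abs_weilOddGroundEnergy_le` / `abs_weilEvenGroundEnergy_le`: `|ε_od(a)|, |ε_ev(a)| ≤ K(1+a)eᵃ` for `a ≥ 1`;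
* `riemannHypothesis_of_towerRatio_growth`: `|r(a)| / ((1+a)eᵃ) → +∞ ⇒ RH`;
* `riemannHypothesis_of_towerRatio_logRate`: `(∀ᶠ a, c·a ≤ log |r(a)|) ⇒ RH` for every `c > 1`;
* `riemannHypothesis_of_towerLogLaw_weil`: **the sign-blind tower log law `log r(a) ~ 4a` for the Weil sector
  bottoms implies RH** (it gives `log |r(a)| ≥ 3a` eventually);
* `eventually_log_towerRatio_le_of_not_riemannHypothesis`: the contrapositive reading — off RH,
  `log |r(a)| ≤ a + log (1+a) + M` eventually.

NOT decided by this argument, and not claimed: bare `TowerDominance` (`r(a) → +∞` with no rate) — off RH it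
would need `ε_od(a) → −∞` while `|ε_ev|` stays `≥ η`, at a rate `≤ (1+a)eᵃ`, which nothing in the tree
excludes; nor that RH implies any of the laws; nor that any law holds for `ζ` (pf's `4a` and the steps are DATA).
𝒞-reading unchanged (MEMBERSHIP.md V10/V26): per-window tower readings are spectral-tier members of `𝒞`
(L1 ⇒ W1 globally); the laws are E1-door statements, whose existence formulations are now DECIDED: RH-strength
as soon as they carry a rate `> 1` in `a`.

References (bib keys of `lean/references.bib`): `Bombieri2000Weil` §4 (Lemma 3 / Thm. 3 a-priori bound, Thm. 5
monotonicity); `ConnesConsaniMoscovici2025` (arXiv:2511.22755) Cor. 3.8.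
-/

noncomputable section

set_option linter.dupNamespace false  -- the mandated namespace repeats `RiemannHypothesis`

open Set Filter Asymptotics
open scoped Real Topology

namespace Summit.RiemannHypothesis.RiemannHypothesis.Theorems.PfPersistence

open Literature.NumberTheory.LFunctions

/-! ## The a-priori size of the sector bottoms, and the strength of tower growth laws -/

/-- PROVED (a-priori size of the ODD sector bottom, RH-free): `|ε_od(a)| ≤ K(1+a)eᵃ` for `a ≥ 1` — below by
Bombieri's floor `ε(a) ≥ −C(1+a)eᵃ` (`weilGroundEnergy_ge_neg_exp`) and `ε ≤ ε_od`; above by monotonicity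
`ε_od(a) ≤ ε_od(1)`. [folklore] -/
theorem abs_weilOddGroundEnergy_le :
    ∃ K : ℝ, 0 < K ∧ ∀ a : ℝ, 1 ≤ a → |weilOddGroundEnergy a| ≤ K * ((1 + a) * Real.exp a) := by
  obtain ⟨C, hC0, hC⟩ := weilGroundEnergy_ge_neg_exp
  refine ⟨C + |weilOddGroundEnergy 1| + 1, by positivity, fun a ha => ?_⟩
  have ha0 : 0 < a := by linarith
  have hE : 1 ≤ (1 + a) * Real.exp a := by
    have h1 : 1 ≤ Real.exp a := Real.one_le_exp ha0.le
    nlinarith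
  have hlow : -(C * (1 + a) * Real.exp a) ≤ weilOddGroundEnergy a :=
    (hC a ha0).trans (weilGroundEnergy_le_weilOddGroundEnergy a)
  have hup : weilOddGroundEnergy a ≤ |weilOddGroundEnergy 1| :=
    (weilOddGroundEnergy_antitoneOn (mem_Ioi.2 one_pos) (mem_Ioi.2 ha0) ha).trans (le_abs_self _)
  have hM : 0 ≤ |weilOddGroundEnergy 1| := abs_nonneg _
  rw [abs_le]
  constructor <;> nlinarith

/-- PROVED (the even twin, RH-free): `|ε_ev(a)| ≤ K(1+a)eᵃ` for `a ≥ 1`. [folklore] -/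
theorem abs_weilEvenGroundEnergy_le :
    ∃ K : ℝ, 0 < K ∧ ∀ a : ℝ, 1 ≤ a → |weilEvenGroundEnergy a| ≤ K * ((1 + a) * Real.exp a) := by
  obtain ⟨C, hC0, hC⟩ := weilGroundEnergy_ge_neg_exp
  refine ⟨C + |weilEvenGroundEnergy 1| + 1, by positivity, fun a ha => ?_⟩
  have ha0 : 0 < a := by linarith
  have hE : 1 ≤ (1 + a) * Real.exp a := by
    have h1 : 1 ≤ Real.exp a := Real.one_le_exp ha0.le
    nlinarith
  have hlow : -(C * (1 + a) * Real.exp a) ≤ weilEvenGroundEnergy a :=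
    (hC a ha0).trans (weilGroundEnergy_le_weilEvenGroundEnergy a)
  have hup : weilEvenGroundEnergy a ≤ |weilEvenGroundEnergy 1| :=
    (weilEvenGroundEnergy_antitoneOn (mem_Ioi.2 one_pos) (mem_Ioi.2 ha0) ha).trans (le_abs_self _)
  have hM : 0 ≤ |weilEvenGroundEnergy 1| := abs_nonneg _
  rw [abs_le]
  constructor <;> nlinarith

/-- PROVED (RH-STRENGTH of fast tower growth, RH-free): if the modulus of the parity-tower ratio
`r(a) = ε_od(a)/ε_ev(a)` grows faster than `(1+a)eᵃ`, i.e. `|r(a)| / ((1+a)eᵃ) → +∞`, then RH.  Off RH,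
`ε_ev(a) ≤ −η` on all large windows (tree) and `|ε_od(a)| ≤ K(1+a)eᵃ`, so the quotient stays `≤ K/η`.
[folklore] -/
theorem riemannHypothesis_of_towerRatio_growth
    (h : Tendsto (fun a : ℝ => |towerRatio weilEvenGroundEnergy weilOddGroundEnergy a| / ((1 + a) * Real.exp a))
      atTop atTop) : RiemannHypothesis := by
  by_contra hRH
  obtain ⟨η, hη, A, hA⟩ := PolarPerronFrobenius.weilEvenGroundEnergy_le_neg_of_not_riemannHypothesis hRH
  obtain ⟨K, hK, hKb⟩ := abs_weilOddGroundEnergy_le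
  have hev : ∀ᶠ a : ℝ in atTop, K / η + 1 ≤
      |towerRatio weilEvenGroundEnergy weilOddGroundEnergy a| / ((1 + a) * Real.exp a) :=
    (tendsto_atTop.1 h) _
  obtain ⟨a, ha, haA, ha1⟩ := (hev.and ((eventually_ge_atTop A).and (eventually_ge_atTop (1 : ℝ)))).exists
  have hE : 0 < (1 + a) * Real.exp a := by
    have := Real.exp_pos a
    nlinarith
  have hden : η ≤ |weilEvenGroundEnergy a| := by
    have h1 := hA a haA
    rw [abs_of_nonpos (by linarith)]
    linarith
  have hnum := hKb a ha1
  have hq : |towerRatio weilEvenGroundEnergy weilOddGroundEnergy a| ≤ K * ((1 + a) * Real.exp a) / η := by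
    rw [towerRatio_def, abs_div]
    exact div_le_div₀ (by positivity) hnum hη hden
  have hq' : |towerRatio weilEvenGroundEnergy weilOddGroundEnergy a| / ((1 + a) * Real.exp a) ≤ K / η := by
    rw [div_le_iff₀ hE]
    calc |towerRatio weilEvenGroundEnergy weilOddGroundEnergy a|
        ≤ K * ((1 + a) * Real.exp a) / η := hq
      _ = K / η * ((1 + a) * Real.exp a) := by ring
  linarith

/-- PROVED (RH-STRENGTH of any exponential LOG-RATE above `1`, RH-free): if eventually `c·a ≤ log |r(a)|` with
`c > 1`, then RH.  (pf's PF-C9 rate is `4`; the sign of `r` is irrelevant.) [folklore] -/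
theorem riemannHypothesis_of_towerRatio_logRate {c : ℝ} (hc : 1 < c)
    (h : ∀ᶠ a : ℝ in atTop, c * a ≤ Real.log |towerRatio weilEvenGroundEnergy weilOddGroundEnergy a|) :
    RiemannHypothesis := by
  refine riemannHypothesis_of_towerRatio_growth ?_
  -- comparison function `e^{(c-1)a} / (2a) → ∞`
  have hcmp : Tendsto (fun a : ℝ => 1 / 2 * (Real.exp ((c - 1) * a) / a ^ (1 : ℝ))) atTop atTop :=
    (tendsto_exp_mul_div_rpow_atTop 1 (c - 1) (by linarith)).const_mul_atTop (by norm_num)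
  refine tendsto_atTop_mono' atTop ?_ hcmp
  filter_upwards [h, eventually_ge_atTop (1 : ℝ)] with a ha ha1
  rw [Real.rpow_one]
  have ha0 : 0 < a := by linarith
  have hE := Real.exp_pos a
  -- `|r a| ≥ e^{ca}` (if `r a = 0` the hypothesis reads `c a ≤ 0`, impossible)
  have hr0 : 0 < |towerRatio weilEvenGroundEnergy weilOddGroundEnergy a| := by
    rcases (abs_nonneg (towerRatio weilEvenGroundEnergy weilOddGroundEnergy a)).eq_or_lt with h0 | h0
    · exfalso
      rw [← h0, Real.log_zero] at ha
      nlinarith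
    · exact h0
  have hge : Real.exp (c * a) ≤ |towerRatio weilEvenGroundEnergy weilOddGroundEnergy a| := by
    calc Real.exp (c * a) ≤ Real.exp (Real.log |towerRatio weilEvenGroundEnergy weilOddGroundEnergy a|) :=
          Real.exp_le_exp.2 ha
      _ = _ := Real.exp_log hr0
  have hsplit : Real.exp (c * a) = Real.exp ((c - 1) * a) * Real.exp a := by
    rw [← Real.exp_add]; ring_nf
  have h2a : (1 + a) * Real.exp a ≤ 2 * a * Real.exp a := by nlinarith
  have hpos2 : 0 < 2 * a * Real.exp a := by positivity
  have hposE : 0 < (1 + a) * Real.exp a := by positivity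
  calc 1 / 2 * (Real.exp ((c - 1) * a) / a)
      = Real.exp ((c - 1) * a) * Real.exp a / (2 * a * Real.exp a) := by
        field_simp
    _ ≤ Real.exp ((c - 1) * a) * Real.exp a / ((1 + a) * Real.exp a) :=
        div_le_div_of_nonneg_left (by positivity) hposE h2a
    _ = Real.exp (c * a) / ((1 + a) * Real.exp a) := by rw [hsplit]
    _ ≤ |towerRatio weilEvenGroundEnergy weilOddGroundEnergy a| / ((1 + a) * Real.exp a) :=
        div_le_div_of_nonneg_right hge hposE.le

/-- PROVED (CORRECTION OF RECORD on PF-C9 / typer V10, V18): the sign-blind TOWER LOG LAW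
`log (ε_od(a)/ε_ev(a)) ~ 4a` for the Weil sector bottoms IMPLIES the Riemann hypothesis, RH-free
(`log r ~ 4a` gives `log |r(a)| ≥ 3a` eventually).  Not claimed: that the law holds, nor that RH implies it,
nor anything about bare `TowerDominance` (no rate). [folklore] -/
theorem riemannHypothesis_of_towerLogLaw_weil (h : TowerLogLaw weilEvenGroundEnergy weilOddGroundEnergy) :
    RiemannHypothesis := by
  refine riemannHypothesis_of_towerRatio_logRate (c := 3) (by norm_num) ?_
  have hlo := h.isLittleO.def (by norm_num : (0 : ℝ) < 1 / 4)
  filter_upwards [hlo, eventually_ge_atTop (0 : ℝ)] with a ha ha0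
  simp only [Pi.sub_apply, Real.norm_eq_abs] at ha
  rw [abs_of_nonneg (by linarith : (0 : ℝ) ≤ 4 * a)] at ha
  have h1 := neg_abs_le (Real.log (towerRatio weilEvenGroundEnergy weilOddGroundEnergy a) - 4 * a)
  rw [Real.log_abs]
  linarith

/-- PROVED (general rate form of the correction): `log |r| ≥ c·a` eventually with ANY `c > 1` is RH-strength;
recorded as the contrapositive reading — off RH, `log |ε_od(a)/ε_ev(a)| ≤ a + log (1+a) + O(1)`. [folklore] -/
theorem eventually_log_towerRatio_le_of_not_riemannHypothesis (hRH : ¬RiemannHypothesis) :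
    ∃ M : ℝ, ∀ᶠ a : ℝ in atTop,
      Real.log |towerRatio weilEvenGroundEnergy weilOddGroundEnergy a| ≤ a + Real.log (1 + a) + M := by
  obtain ⟨η, hη, A, hA⟩ := PolarPerronFrobenius.weilEvenGroundEnergy_le_neg_of_not_riemannHypothesis hRH
  obtain ⟨K, hK, hKb⟩ := abs_weilOddGroundEnergy_le
  refine ⟨|Real.log (K / η)|, ?_⟩
  filter_upwards [eventually_ge_atTop A, eventually_ge_atTop (1 : ℝ)] with a haA ha1
  have hE : 0 < (1 + a) * Real.exp a := by positivity
  have hden : η ≤ |weilEvenGroundEnergy a| := by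
    have h1 := hA a haA
    rw [abs_of_nonpos (by linarith)]
    linarith
  have hq : |towerRatio weilEvenGroundEnergy weilOddGroundEnergy a| ≤ K / η * ((1 + a) * Real.exp a) := by
    rw [towerRatio_def, abs_div]
    calc |weilOddGroundEnergy a| / |weilEvenGroundEnergy a|
        ≤ K * ((1 + a) * Real.exp a) / η := div_le_div₀ (by positivity) (hKb a ha1) hη hden
      _ = K / η * ((1 + a) * Real.exp a) := by ring
  have hlog1 : 0 ≤ Real.log (1 + a) := Real.log_nonneg (by linarith)
  have hM : Real.log (K / η) ≤ |Real.log (K / η)| := le_abs_self _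
  have hM0 : 0 ≤ |Real.log (K / η)| := abs_nonneg _
  rcases (abs_nonneg (towerRatio weilEvenGroundEnergy weilOddGroundEnergy a)).eq_or_lt with h0 | h0
  · rw [← h0, Real.log_zero]
    linarith
  · calc Real.log |towerRatio weilEvenGroundEnergy weilOddGroundEnergy a|
        ≤ Real.log (K / η * ((1 + a) * Real.exp a)) := Real.log_le_log h0 hq
      _ = Real.log (K / η) + (Real.log (1 + a) + a) := by
          rw [Real.log_mul (by positivity) hE.ne', Real.log_mul (by positivity) (Real.exp_pos a).ne',
            Real.log_exp]
      _ ≤ a + Real.log (1 + a) + |Real.log (K / η)| := by linarith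

end Summit.RiemannHypothesis.RiemannHypothesis.Theorems.PfPersistence

end
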